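import Summits.KontsevichZagierPeriods.KontsevichZagierPeriods.Theorems.K2SymbolChainsJensenIsScissorsRotationAux
import Summits.KontsevichZagierPeriods.KontsevichZagierPeriods.Theorems.K2SymbolChainsJensenIsScissorsBaseLift

/-!
# Jensen is scissors — the rotation step: `W_α` to `W_ρ` by a change of variables

Support file for item stmt-KontsevichZagierPeriods-5204 (`JensenIsScissors`, route
KontsevichZagierPeriods/K2SymbolChains). Over the smooth locus `B` of the centre `α = α₁ + iα₂ ≠ 0`
the signed unfolding of `h(x)/(1 + s²) · log W_α(x, s)` over `B × ℝ` is carried, inside any subgroup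
`S` containing the three scissors move sets, to the signed unfolding of
`h(x)/(1 + s²) · log W_ρ(x, s)`, `W_ρ(s) = ((1 − ρ)² + (1 + ρ)² s²)/(1 + s²)`, `ρ = |α(x)|`: the
rotation `s ↦ P/Q` of the rational circle (file `Algebra`) is a rule-2) datum on the complement of
its pole set `{Q = 0}` (null), lifted to the `u`-coordinate (file `BaseLift`); it carries `W_α` to
`W_ρ` and preserves `ds/(1 + s²)`; the complement of its image is the pole set of the inverse
rotation (null). [Kontsevich–Zagier 2001, §1.2, rules 1)–2)] [folklore]
-/

noncomputable section

open MeasureTheory Set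
open Literature.NumberTheory.Transcendental Literature.ModelTheory.ExponentialFields

namespace Summit.KontsevichZagierPeriods.K2SymbolChains.JensenIsScissorsProof

open Literature.NumberTheory.Transcendental.KZ

variable {n : ℕ} {S : AddSubgroup FormalRep}

/-- **The rotation step.** See the module docstring. [Kontsevich–Zagier 2001, §1.2] [folklore] -/
theorem rotation_step (hS : domainAddRel ∪ integrandAddRel ∪ changeOfVariablesRel ⊆ S)
    {B : Set (Fin n → ℝ)} {h α₁ α₂ : (Fin n → ℝ) → ℝ}
    (hB : IsSemialgebraic ℚ B) (hh : IsSemialgebraicFunOn ℚ B h)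
    (hα₁ : IsSemialgebraicFunOn ℚ B α₁) (hα₂ : IsSemialgebraicFunOn ℚ B α₂)
    (hne : ∀ x ∈ B, α₁ x ^ 2 + α₂ x ^ 2 ≠ 0)
    (hd₁ : ∀ x ∈ B, DifferentiableAt ℝ α₁ x) (hd₂ : ∀ x ∈ B, DifferentiableAt ℝ α₂ x)
    (R : IntegralRep (n + 1 + 1))
    (hRd : R.domain = logUnfoldDomain {b : Fin (n + 1) → ℝ | Fin.init b ∈ B}
      (fun b => ((1 - b (Fin.last n) ^ 2) / (1 + b (Fin.last n) ^ 2) - α₁ (Fin.init b)) ^ 2 +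
        (2 * b (Fin.last n) / (1 + b (Fin.last n) ^ 2) - α₂ (Fin.init b)) ^ 2))
    (hRi : EqOn R.integrand
      (logUnfoldIntegrand fun b => h (Fin.init b) / (1 + b (Fin.last n) ^ 2)) R.domain) :
    ∃ R' : IntegralRep (n + 1 + 1),
      R'.domain = logUnfoldDomain {b : Fin (n + 1) → ℝ | Fin.init b ∈ B}
        (fun b => ((1 - Real.sqrt (α₁ (Fin.init b) ^ 2 + α₂ (Fin.init b) ^ 2)) ^ 2 +
          (1 + Real.sqrt (α₁ (Fin.init b) ^ 2 + α₂ (Fin.init b) ^ 2)) ^ 2 * b (Fin.last n) ^ 2) /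
          (1 + b (Fin.last n) ^ 2)) ∧
      R'.integrand = logUnfoldIntegrand (fun b => h (Fin.init b) / (1 + b (Fin.last n) ^ 2)) ∧
      of R - of R' ∈ S := by
  -- notation
  set T : Set (Fin (n + 1) → ℝ) := {b | Fin.init b ∈ B} with hT_def
  set ρ : (Fin n → ℝ) → ℝ := fun x => Real.sqrt (α₁ x ^ 2 + α₂ x ^ 2) with hρ_def
  set G : (Fin (n + 1) → ℝ) → ℝ := fun b => h (Fin.init b) / (1 + b (Fin.last n) ^ 2) with hG_def
  set Wα : (Fin (n + 1) → ℝ) → ℝ := fun b =>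
    ((1 - b (Fin.last n) ^ 2) / (1 + b (Fin.last n) ^ 2) - α₁ (Fin.init b)) ^ 2 +
      (2 * b (Fin.last n) / (1 + b (Fin.last n) ^ 2) - α₂ (Fin.init b)) ^ 2 with hWα_def
  set Wρ : (Fin (n + 1) → ℝ) → ℝ := fun b =>
    ((1 - ρ (Fin.init b)) ^ 2 + (1 + ρ (Fin.init b)) ^ 2 * b (Fin.last n) ^ 2) /
      (1 + b (Fin.last n) ^ 2) with hWρ_def
  set Pf : (Fin (n + 1) → ℝ) → ℝ := fun b =>
    α₂ (Fin.init b) * b (Fin.last n) ^ 2 + 2 * α₁ (Fin.init b) * b (Fin.last n) - α₂ (Fin.init b)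
    with hPf_def
  set Qf : (Fin (n + 1) → ℝ) → ℝ := fun b =>
    (ρ (Fin.init b) - α₁ (Fin.init b)) * b (Fin.last n) ^ 2 + 2 * α₂ (Fin.init b) * b (Fin.last n) +
      (ρ (Fin.init b) + α₁ (Fin.init b)) with hQf_def
  set Ptf : (Fin (n + 1) → ℝ) → ℝ := fun b =>
    (-α₂ (Fin.init b)) * b (Fin.last n) ^ 2 + 2 * α₁ (Fin.init b) * b (Fin.last n) - (-α₂ (Fin.init b))
    with hPtf_def
  set Qtf : (Fin (n + 1) → ℝ) → ℝ := fun b =>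
    (ρ (Fin.init b) - α₁ (Fin.init b)) * b (Fin.last n) ^ 2 + 2 * (-α₂ (Fin.init b)) * b (Fin.last n) +
      (ρ (Fin.init b) + α₁ (Fin.init b)) with hQtf_def
  set mf : (Fin (n + 1) → ℝ) → ℝ := fun b => Pf b / Qf b with hmf_def
  set mtf : (Fin (n + 1) → ℝ) → ℝ := fun b => Ptf b / Qtf b with hmtf_def
  set Ψ : (Fin (n + 1) → ℝ) → (Fin (n + 1) → ℝ) := fun b => Fin.snoc (Fin.init b) (mf b) with hΨ_def
  set Ψt : (Fin (n + 1) → ℝ) → (Fin (n + 1) → ℝ) := fun b => Fin.snoc (Fin.init b) (mtf b) with hΨt_def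
  -- pointwise facts over `B`
  have hρx : ∀ x ∈ B, ρ x ^ 2 = α₁ x ^ 2 + α₂ x ^ 2 ∧ 0 < ρ x := fun x hx => modulus_sq_pos (hne x hx)
  have hρx' : ∀ x ∈ B, ρ x ^ 2 = α₁ x ^ 2 + (-α₂ x) ^ 2 := fun x hx => by rw [neg_sq]; exact (hρx x hx).1
  have hQnn : ∀ b ∈ T, 0 ≤ Qf b := fun b hb => rot_den_nonneg _ _ _ _ (hρx _ hb).1 (hρx _ hb).2
  have hQtnn : ∀ b ∈ T, 0 ≤ Qtf b := fun b hb => rot_den_nonneg _ _ _ _ (hρx' _ hb) (hρx _ hb).2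
  -- the two good bases
  set σ : Set (Fin (n + 1) → ℝ) := {b | b ∈ T ∧ Qf b ≠ 0} with hσ_def
  set σt : Set (Fin (n + 1) → ℝ) := {b | b ∈ T ∧ Qtf b ≠ 0} with hσt_def
  -- composition identities
  have hcomp₁ : ∀ b ∈ σ, Qtf (Ψ b) = 4 * ρ (Fin.init b) ^ 2 / Qf b := fun b hb => by
    simp only [hQtf_def, hΨ_def, hmf_def, hPf_def, hQf_def, Fin.init_snoc, Fin.snoc_last]
    exact rot_den_comp (hρx _ hb.1).1 hb.2
  have hcomp₂ : ∀ b ∈ σ, mtf (Ψ b) = b (Fin.last n) := fun b hb => by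
    simp only [hmtf_def, hPtf_def, hQtf_def, hΨ_def, hmf_def, hPf_def, hQf_def, Fin.init_snoc, Fin.snoc_last]
    exact rot_num_comp (hρx _ hb.1).1 (hρx _ hb.1).2 hb.2
  have hcomp₃ : ∀ b ∈ σt, Qf (Ψt b) = 4 * ρ (Fin.init b) ^ 2 / Qtf b := fun b hb => by
    simp only [hQtf_def, hΨt_def, hmtf_def, hPtf_def, hQf_def, Fin.init_snoc, Fin.snoc_last]
    have := rot_den_comp (s := b (Fin.last n)) (hρx' _ hb.1) hb.2
    simp only [neg_neg] at this
    convert this using 2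
  have hcomp₄ : ∀ b ∈ σt, mf (Ψt b) = b (Fin.last n) := fun b hb => by
    simp only [hmf_def, hPf_def, hQf_def, hΨt_def, hmtf_def, hPtf_def, hQtf_def, Fin.init_snoc, Fin.snoc_last]
    have := rot_num_comp (s := b (Fin.last n)) (hρx' _ hb.1) (hρx _ hb.1).2 hb.2
    simp only [neg_neg] at this
    convert this using 2
  have hΨσ : ∀ b ∈ σ, Ψ b ∈ σt := fun b hb => by
    refine ⟨by simpa [hΨ_def, hT_def] using hb.1, ?_⟩
    rw [hcomp₁ b hb]
    exact div_ne_zero (by have := (hρx _ hb.1).2; positivity) hb.2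
  have hΨtσ : ∀ b ∈ σt, Ψt b ∈ σ := fun b hb => by
    refine ⟨by simpa [hΨt_def, hT_def] using hb.1, ?_⟩
    rw [hcomp₃ b hb]
    exact div_ne_zero (by have := (hρx _ hb.1).2; positivity) hb.2
  have hΨtΨ : ∀ b ∈ σ, Ψt (Ψ b) = b := fun b hb => by
    have h1 : Fin.init (Ψ b) = Fin.init b := by simp [hΨ_def]
    simp only [hΨt_def]
    rw [hcomp₂ b hb, h1, Fin.snoc_init_self]
  have hΨΨt : ∀ b ∈ σt, Ψ (Ψt b) = b := fun b hb => by
    have h1 : Fin.init (Ψt b) = Fin.init b := by simp [hΨt_def]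
    simp only [hΨ_def]
    rw [hcomp₄ b hb, h1, Fin.snoc_init_self]
  have hW : ∀ b ∈ σ, Wα b = Wρ (Ψ b) := fun b hb => by
    simp only [hWα_def, hWρ_def, hΨ_def, hmf_def, hPf_def, hQf_def, Fin.init_snoc, Fin.snoc_last]
    exact rot_W _ _ _ _ (hρx _ hb.1).1 hb.2
  -- the derivative of the rotation along `s` and the weight identity
  have hderiv : ∀ b ∈ σ, HasDerivAt (fun t : ℝ => mf (Fin.snoc (Fin.init b) t))
      (2 * ρ (Fin.init b) / Qf b) (b (Fin.last n)) := fun b hb => by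
    have h := hasDerivAt_quad_div (c₀ := -α₂ (Fin.init b)) (c₁ := 2 * α₁ (Fin.init b))
      (c₂ := α₂ (Fin.init b)) (d₀ := ρ (Fin.init b) + α₁ (Fin.init b)) (d₁ := 2 * α₂ (Fin.init b))
      (d₂ := ρ (Fin.init b) - α₁ (Fin.init b)) (t := b (Fin.last n)) (by
        have := hb.2; simp only [hQf_def] at this; convert this using 1)
    have hval := rot_deriv_val (s := b (Fin.last n)) (hρx _ hb.1).1 hb.2
    have hfun : (fun t : ℝ => mf (Fin.snoc (Fin.init b) t)) = fun t =>
        (α₂ (Fin.init b) * t ^ 2 + 2 * α₁ (Fin.init b) * t + -α₂ (Fin.init b)) /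
          ((ρ (Fin.init b) - α₁ (Fin.init b)) * t ^ 2 + 2 * α₂ (Fin.init b) * t +
            (ρ (Fin.init b) + α₁ (Fin.init b))) := by
      funext t
      simp only [hmf_def, hPf_def, hQf_def, Fin.init_snoc, Fin.snoc_last, sub_eq_add_neg]
    rw [hfun]
    refine h.congr_deriv ?_
    rw [← hval]
    congr 1
  have hdiff : ∀ b ∈ σ, DifferentiableAt ℝ mf b := fun b hb => by
    have hx : Fin.init b ∈ B := hb.1
    have hρd : DifferentiableAt ℝ ρ (Fin.init b) := differentiableAt_modulus (hd₁ _ hx) (hd₂ _ hx) (hne _ hx)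
    have hP : DifferentiableAt ℝ Pf b := by
      have := differentiableAt_quad (n := n) (b := b) (c₀ := fun x => -α₂ x) (c₁ := fun x => 2 * α₁ x)
        (c₂ := α₂) (hd₂ _ hx).neg ((hd₁ _ hx).const_mul 2) (hd₂ _ hx)
      simp only [hPf_def]
      convert this using 1
      funext b
      ring
    have hQ : DifferentiableAt ℝ Qf b := by
      have := differentiableAt_quad (n := n) (b := b) (c₀ := fun x => ρ x + α₁ x) (c₁ := fun x => 2 * α₂ x)
        (c₂ := fun x => ρ x - α₁ x) (hρd.add (hd₁ _ hx)) ((hd₂ _ hx).const_mul 2) (hρd.sub (hd₁ _ hx))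
      simp only [hQf_def]
      exact this
    simp only [hmf_def, div_eq_mul_inv]
    exact hP.mul (hQ.inv hb.2)
  have hfd : ∀ b ∈ σ, fderiv ℝ mf b (Pi.single (Fin.last n) 1) = 2 * ρ (Fin.init b) / Qf b :=
    fun b hb => fderiv_apply_single_last (hdiff b hb).hasFDerivAt (hderiv b hb)
  have hdetpos : ∀ b ∈ σ, 0 < 2 * ρ (Fin.init b) / Qf b := fun b hb =>
    div_pos (by have := (hρx _ hb.1).2; positivity) (rot_den_pos (hρx _ hb.1).1 (hρx _ hb.1).2 hb.2)
  have hwt : ∀ b ∈ σ, G (Ψ b) * (2 * ρ (Fin.init b) / Qf b) = G b := fun b hb => by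
    simp only [hG_def, hΨ_def, hmf_def, hPf_def, hQf_def, Fin.init_snoc, Fin.snoc_last]
    exact rot_weight _ (hρx _ hb.1).1 (hρx _ hb.1).2 hb.2
  -- semialgebraicity
  have hT : IsSemialgebraic ℚ T := isSemialgebraic_cyl hB
  have hρs : IsSemialgebraicFunOn ℚ B ρ := isSemialgebraicFunOn_modulus hα₁ hα₂
  have hPs : IsSemialgebraicFunOn ℚ T Pf :=
    (isSemialgebraicFunOn_quad (c₀ := fun x => -α₂ x) (c₁ := fun x => 2 * α₁ x) (c₂ := α₂) hα₂.neg
      ((IsSemialgebraicFunOn.mul_holds (isSemialgebraicFunOn_ratCast hB 2) hα₁).congr fun x _ => by simp)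
      hα₂ hT subset_rfl).congr fun b _ => by simp only [hPf_def]; ring
  have hQs : IsSemialgebraicFunOn ℚ T Qf :=
    (isSemialgebraicFunOn_quad (c₀ := fun x => ρ x + α₁ x) (c₁ := fun x => 2 * α₂ x)
      (c₂ := fun x => ρ x - α₁ x) (IsSemialgebraicFunOn.add_holds hρs hα₁)
      ((IsSemialgebraicFunOn.mul_holds (isSemialgebraicFunOn_ratCast hB 2) hα₂).congr fun x _ => by simp)
      (IsSemialgebraicFunOn.sub_holds hρs hα₁) hT subset_rfl).congr fun b _ => by simp only [hQf_def]
  have hQts : IsSemialgebraicFunOn ℚ T Qtf :=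
    (isSemialgebraicFunOn_quad (c₀ := fun x => ρ x + α₁ x) (c₁ := fun x => 2 * (-α₂ x))
      (c₂ := fun x => ρ x - α₁ x) (IsSemialgebraicFunOn.add_holds hρs hα₁)
      ((IsSemialgebraicFunOn.mul_holds (isSemialgebraicFunOn_ratCast hB 2) hα₂.neg).congr fun x _ => by simp)
      (IsSemialgebraicFunOn.sub_holds hρs hα₁) hT subset_rfl).congr fun b _ => by simp only [hQtf_def]
  have hσs : IsSemialgebraic ℚ σ := hQs.isSemialgebraic_sep_ne_zero
  have hσts : IsSemialgebraic ℚ σt := hQts.isSemialgebraic_sep_ne_zero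
  have hσT : σ ⊆ T := fun b hb => hb.1
  have hσtT : σt ⊆ T := fun b hb => hb.1
  have hσB : σ ⊆ {b | Fin.init b ∈ B} := hσT
  have hσtB : σt ⊆ {b | Fin.init b ∈ B} := hσtT
  have hmfs : IsSemialgebraicFunOn ℚ σ mf :=
    IsSemialgebraicFunOn.div (hPs.mono hσT hσs) (hQs.mono hσT hσs) fun b hb => hb.2
  have hGσt : IsSemialgebraicFunOn ℚ σt G := isSemialgebraicFunOn_weight hh hσts hσtB
  have hGT : IsSemialgebraicFunOn ℚ T G := isSemialgebraicFunOn_weight hh hT subset_rfl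
  have hWρT : IsSemialgebraicFunOn ℚ T Wρ := isSemialgebraicFunOn_Wreal hρs hT subset_rfl
  have hWρσt : IsSemialgebraicFunOn ℚ σt Wρ := hWρT.mono hσtT hσts
  have hWρ0 : ∀ b ∈ T, 0 ≤ Wρ b := fun b _ => by simp only [hWρ_def]; positivity
  -- null pole sets
  have hpole : volume {b | b ∈ T ∧ Qf b = 0} = 0 := volume_rot_poles_eq_zero hB hα₁ hα₂ hne
  have hpolet : volume {b | b ∈ T ∧ Qtf b = 0} = 0 := by
    have := volume_rot_poles_eq_zero (α₂ := fun x => -α₂ x) hB hα₁ hα₂.neg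
      (fun x hx => by rw [neg_sq]; exact hne x hx)
    simp only [neg_sq] at this
    exact this
  -- step 1: restrict `R` to the good base `σ`
  have s1 := of_sub_restrict_base_mem hS R hσs
  set R₁ := R.restrict (R.domain ∩ {z | Fin.init z ∈ σ})
    (R.isSemialgebraic_domain.inter (isSemialgebraic_cyl hσs)) inter_subset_left with hR₁
  set R₂ := R.restrict (R.domain \ {z | Fin.init z ∈ σ})
    (R.isSemialgebraic_domain.diff (isSemialgebraic_cyl hσs)) sdiff_subset with hR₂
  have hR₂ : of R₂ ∈ S := by
    refine of_mem_of_base_null hS R₂ hpole fun z hz => ?_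
    rw [hR₂, IntegralRep.domain_restrict, hRd] at hz
    have hzT : Fin.init z ∈ T := hz.1.1
    have hnot : ¬ Fin.init z ∈ σ := hz.2
    simp only [hσ_def, mem_setOf_eq, not_and, not_not] at hnot
    exact ⟨hzT, hnot hzT⟩
  have hR₁d : R₁.domain = logUnfoldDomain σ Wα := by
    rw [hR₁, IntegralRep.domain_restrict, hRd, logUnfoldDomain_inter_cyl, inter_eq_right.2 hσT]
  -- step 2: the rotation as a base change of variables
  obtain ⟨hmap, hder, hinj⟩ := lastCoord_covData_basic (m := n) hσs hmfs
    (F' := fun b => fderiv ℝ mf b) (fun b hb => (hdiff b hb).hasFDerivAt) (fun b₁ hb₁ b₂ hb₂ hi hm => by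
      rw [← hΨtΨ b₁ hb₁, ← hΨtΨ b₂ hb₂]
      simp only [hΨ_def, hi, hm])
  obtain ⟨R'', hR''d, hR''i, s2⟩ := exists_image_baseLift hS hmap hder hinj R₁
    (by rw [hR₁d]; exact fun z hz => hz.1) (D' := logUnfoldDomain σt Wρ) (fun z hz => by
      obtain ⟨hb, -⟩ := hz
      exact ⟨Ψt (Fin.init z), hΨtσ _ hb, hΨΨt _ hb⟩)
    (fun b hb u => by
      rw [hR₁d, snoc_mem_logUnfoldDomain, snoc_mem_logUnfoldDomain, hW b hb]
      exact ⟨fun h => ⟨hΨσ b hb, h.2⟩, fun h => ⟨hb, h.2⟩⟩)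
    (f' := logUnfoldIntegrand G)
    (isSemialgebraicFunOn_logUnfoldIntegrand hGσt hWρσt fun b hb => hWρ0 b (hσtT hb))
    (fun z hz => by
      have hb : Fin.init z ∈ σ := by rw [hR₁d] at hz; exact hz.1
      have hzR : z ∈ R.domain := hz.1
      rw [hR₁, IntegralRep.integrand_restrict, hRi hzR, det_lastCoordDeriv, hfd _ hb,
        abs_of_pos (hdetpos _ hb), logUnfoldIntegrand, logUnfoldIntegrand]
      simp only [Fin.init_snoc, Fin.snoc_last]
      rw [← hwt _ hb]
      simp only [hΨ_def]
      ring)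
  -- step 3: extend the image to the full base `T`
  obtain ⟨R', hR'd, hR'i, s3⟩ := exists_extend_null hS R'' (D := logUnfoldDomain T Wρ)
    (isSemialgebraic_logUnfoldDomain hWρT) (by rw [hR''d]; exact fun z hz => ⟨hσtT hz.1, hz.2⟩)
    (by
      rw [hR''d]
      refine measure_mono_null (fun z hz => ?_) (volume_setOf_init_mem_eq_zero hpolet)
      obtain ⟨⟨hzT, hu⟩, hn⟩ := hz
      have : ¬ (Fin.init z ∈ σt) := fun h => hn ⟨h, hu⟩
      simp only [hσt_def, mem_setOf_eq, not_and, not_not] at this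
      exact ⟨hzT, this hzT⟩)
    (f := logUnfoldIntegrand G) (isSemialgebraicFunOn_logUnfoldIntegrand hGT hWρT hWρ0)
    (by rw [hR''i]; exact fun _ _ => rfl)
  refine ⟨R', hR'd, hR'i, ?_⟩
  have : of R - of R' = (of R - of R₁ - of R₂) + of R₂ + (of R₁ - of R'') - (of R' - of R'') := by abel
  rw [this]
  exact S.sub_mem (S.add_mem (S.add_mem s1 hR₂) s2) s3

end Summit.KontsevichZagierPeriods.K2SymbolChains.JensenIsScissorsProof
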